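import Summits.QuantumFields.YangMills.Theorems.LangevinControlUVFemtoCurvatureSkewnessDefs

/-!
# Route `LangevinControlUV`, crux `FemtoCurvatureSkewnessC` (stmt-QuantumFields-16205): vocabulary of line `ratio-transport`

Route-posited objects (D-0016 `<Route><Crux>Defs` file) of the checked skeleton of line `ratio-transport` (slug `Sketch`,
planner `planner-cruxidea-stmt-QuantumFields-16205-1-0`, lead `prover-line-stmt-QuantumFields-16205-0`), namespace
`Summit.QuantumFields.YangMills.Cruxes.FemtoCurvatureSkewnessC.RatioTransport`, so that the stub signatures registered on the
crux item (`stub_ratioTransportEngine`, `stub_anchors`, `stub_ratioFloorOfTransports`, `stub_signedRigidityOfRatioFloor`)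
are statable from `Theorems/` and the stubs become landable there.  NOTHING here is asserted: every `def … : Prop` is a line
statement that some registered stub proves or consumes; none is a literature fact; none restates the crux
(`femtoCurvatureSkewnessC_iff` in `…SkewnessImpliesC.lean` is `Iff.rfl` over the landed `TwoPointPackage` / `SkewnessPackage`).

TRANSPORT, DON'T EVALUATE (idea card `Cruxes/FemtoCurvatureSkewnessC/Ideas/ratio-transport.md`): the tree-normalised skewness
ratio `u(L,β,n) := κ₃ · G_a / (Cov^{3/2} · G_d)` (`skewRatioT`; `G_a`, `G_d` = the explicit zero-mode-free transverse torus
propagators `torusPropAxis`, `torusPropDiag` of the landed `PerpPropagatorPos` / `TreeRatioFloor`; tree value `2^{3/2}d^{-1/2}`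
exactly) is carried from fixed-torus `β → ∞` corners (`FixedTorusAnchors`) to every femto box of an honest package map by three
SIGN-FREE transports — cutoff halving along the map's RG chain (`CutoffTransport`, summable increments), volume reduction at
fixed coupling (`VolumeTransport`), separation `±1` (`SeparationTransport`).  A positive floor of `u` (`RatioFloor`) is
`SignedRigidity` (landed `TreeRatioFloor`), hence the skewness package (landed `skewnessPackage_of_signedRigidity`), hence the
served crux (landed `femtoCurvatureSkewnessC_iff`).

Lead's reshape of the card's vocabulary (2026-08-16, recorded in `Cruxes/FemtoCurvatureSkewnessC/PICKED.md`):
* `FixedTorusAnchors` carries ONE anchor constant `u₀ > 0` UNIFORM over all admissible fixed tori `(L₀, n₀)` (the thresholds in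
  `β` stay pointwise).  With the card's pointwise `∃ u₀(L₀,n₀)` the composition `anchors + transports ⇒ floor` is false as an
  abstract real-analysis statement (witness `u(L,β,n) = 1/log(n+2)`, `a = exp(−β)`: all three transports and pointwise anchors
  hold, the femto floor fails) — the card's choice of `N₀, K₀` from `u_A = min` over an `N₀, K₀`-dependent family is circular.
* `Anchors` is asked only for `(G, r)` at which some continuous unit map carries the two-point package (the crux's own
  hypothesis), so degenerate pairs cost nothing.

Refs: idea card `Cruxes/FemtoCurvatureSkewnessC/Ideas/ratio-transport.md`; skeleton `Cruxes/FemtoCurvatureSkewnessC/Lines/Sketch.lean`;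
predecessor vocabulary `LangevinControlUVFemtoCurvatureSkewnessDefs.lean` (`covAxis`, `torusPropAxis/Diag`, `IsHonestUnitMap`,
`SignedRigidity`).
-/

set_option autoImplicit false

noncomputable section

namespace Summit.QuantumFields.YangMills.Cruxes.FemtoCurvatureSkewnessC.RatioTransport

open MeasureTheory Filter Topology
open scoped BigOperators
open Literature.MathematicalPhysics.QuantumFieldTheory
open Summit.QuantumFields.YangMills.Theorems.FemtoCurvatureSkewness.Negative
  (plaq wE wCov kappa3 TwoPointPackage SkewnessPackage)
open Summit.QuantumFields.YangMills.Cruxes.FemtoCurvatureSkewness.CouplingCubicResponse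
  (covAxis torusPropAxis torusPropDiag IsHonestUnitMap SignedRigidity)

section Vocabulary

variable {G : Type} [Group G] [TopologicalSpace G] [IsTopologicalGroup G] [CompactSpace G]
  [MeasurableSpace G] [BorelSpace G]

/-- **The tree-normalised skewness ratio** `u(L,β,n) := κ₃(L,β,n) · G_a(L,n) / (Cov_axis(L,β,n)^{3/2} · G_d(L,n))`.
At tree level (permanental triangle `κ₃ = 8dλ³G_a²G_d`, `Cov = 2dλ²G_a²`) it equals the pure number `2^{3/2} d^{-1/2}`
— independent of `L`, `β`, `n`, of the coupling factor `λ`, of the composite normalisation and of the lattice artefacts of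
`G_a`, `G_d` (which are divided out EXACTLY).  Meaningful where `Cov_axis > 0` (guaranteed on package boxes). -/
def skewRatioT (r : LatticeRep G) (L : ℕ) [NeZero L] (β : ℝ) (n : ℕ) : ℝ :=
  kappa3 r L β n * torusPropAxis L n / ((covAxis r L β n) ^ (3 / 2 : ℝ) * torusPropDiag L n)

/-- **(A) Fixed-torus anchors — FTEN with value, UNIFORM constant.**  There is ONE `u₀ > 0` such that on every FIXED torus
`L₀ ≥ 8n₀`, `n₀ ≥ 1`, the ratio is eventually (as `β → ∞`) at least `u₀` (finite-dimensional Laplace asymptotics around the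
flat-connection variety, torons included: the limit is `2^{3/2}d^{-1/2}(1 + O((n₀/L₀)⁴))`, the lattice artefacts being divided
out exactly).  The thresholds in `β` are pointwise in `(L₀, n₀)`; the line only ever USES finitely many of them.  This is the
ONLY signed input of the line. -/
def FixedTorusAnchors (r : LatticeRep G) : Prop :=
  ∃ u₀ : ℝ, 0 < u₀ ∧ ∀ (L₀ n₀ : ℕ) [NeZero L₀], 1 ≤ n₀ → 8 * n₀ ≤ L₀ →
    ∀ᶠ β in atTop, u₀ ≤ skewRatioT r L₀ β n₀

/-- **(T_c) Cutoff transport along the dyadic RG chain of the unit map `a`** (sign-free; the engine statement of the line):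
halving the cutoff at fixed physical triangle and box — `(L,β,n) ↦ (2L, β⁺, 2n)` with `2·a(β⁺) = a(β)` — moves the ratio by at
most `ε(n)`, and the increments are summable along every dyadic chain with a tail that is small for large starting separation. -/
def CutoffTransport (r : LatticeRep G) (a : ℝ → ℝ) : Prop :=
  ∃ (β₁ ℓ₁ : ℝ) (ε : ℕ → ℝ), 0 < ℓ₁ ∧
    (∀ δ : ℝ, 0 < δ → ∃ N₀ : ℕ, 1 ≤ N₀ ∧ ∀ n₀ K : ℕ, N₀ ≤ n₀ → ∑ k ∈ Finset.range K, ε (2 ^ k * n₀) ≤ δ) ∧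
    ∀ (L L' : ℕ) [NeZero L] [NeZero L'] (β β' : ℝ) (n : ℕ), β₁ ≤ β → (L : ℝ) * a β ≤ ℓ₁ → 1 ≤ n → 8 * n ≤ L →
      L' = 2 * L → 2 * a β' = a β →
        |skewRatioT r L' β' (2 * n) - skewRatioT r L β n| ≤ ε n

/-- **(T_v) Volume transport at fixed coupling** (sign-free, DIFFERENTIAL form): at the same `β` and `n`, shrinking the
femto torus from `L` to `L' ∈ [L/2, L]` (`L' ≥ 8n`) moves the ratio by at most `C_V (n/L')⁴ · (L − L')/L'` — the triangle feels
the box only through modes of wavelength `≥ L'` (zero modes / torons / images), a finite-size correction of relative size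
`(n/L')⁴` that is smooth in the box size.  Telescoped over dyadic `L'` it gives `(16/15)·C_V (n/L')⁴` for ANY `8n ≤ L' ≤ L`. -/
def VolumeTransport (r : LatticeRep G) (a : ℝ → ℝ) : Prop :=
  ∃ (β₁ ℓ₁ C_V : ℝ), 0 < ℓ₁ ∧
    ∀ (L L' : ℕ) [NeZero L] [NeZero L'] (β : ℝ) (n : ℕ), β₁ ≤ β → (L : ℝ) * a β ≤ ℓ₁ →
      1 ≤ n → 8 * n ≤ L' → L' ≤ L → L ≤ 2 * L' →
        |skewRatioT r L β n - skewRatioT r L' β n| ≤ C_V * ((n : ℝ) / L') ^ 4 * (((L : ℝ) - L') / L')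

/-- **(T_s) Separation transport** (sign-free): at fixed `(L, β)` the ratio is `C_S/n`-Lipschitz in the separation (smoothness of
the two- and three-point functions in one position at scale `n`). -/
def SeparationTransport (r : LatticeRep G) (a : ℝ → ℝ) : Prop :=
  ∃ (β₁ ℓ₁ C_S : ℝ), 0 < ℓ₁ ∧
    ∀ (L : ℕ) [NeZero L] (β : ℝ) (n : ℕ), β₁ ≤ β → (L : ℝ) * a β ≤ ℓ₁ →
      1 ≤ n → 8 * (n + 1) ≤ L →
        |skewRatioT r L β (n + 1) - skewRatioT r L β n| ≤ C_S / n

/-- A positive floor of the ratio on the femto boxes of `a`. -/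
def RatioFloor (r : LatticeRep G) (a : ℝ → ℝ) : Prop :=
  ∃ (β₁ ℓ₁ u₁ : ℝ), 0 < ℓ₁ ∧ 0 < u₁ ∧
    ∀ (L : ℕ) [NeZero L] (β : ℝ) (n : ℕ), β₁ ≤ β → (L : ℝ) * a β ≤ ℓ₁ →
      1 ≤ n → 8 * n ≤ L → u₁ ≤ skewRatioT r L β n

end Vocabulary

/-- **The engine statement of the line (shape of the landed `MarkedCouplingDominance`, sign-free content):** for compact simple
`G` and any `r`, if some continuous unit map carries the two-point package then some HONEST unit map carries the package together
with the three transports. -/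
def RatioTransportEngine : Prop :=
  ∀ (G : Type) [Group G] [TopologicalSpace G] [IsTopologicalGroup G] [CompactSpace G]
    [MeasurableSpace G] [BorelSpace G], IsCompactSimpleLieGroup G →
    ∀ (r : LatticeRep G), (∃ a : ℝ → ℝ, Continuous a ∧ TwoPointPackage r a) →
      ∃ a : ℝ → ℝ, IsHonestUnitMap a ∧ TwoPointPackage r a ∧
        CutoffTransport r a ∧ VolumeTransport r a ∧ SeparationTransport r a

/-- **The anchors, for every compact simple `G` and every `r` at which the crux's hypothesis holds** (some continuous unit
map carries the two-point package). -/
def Anchors : Prop :=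
  ∀ (G : Type) [Group G] [TopologicalSpace G] [IsTopologicalGroup G] [CompactSpace G]
    [MeasurableSpace G] [BorelSpace G], IsCompactSimpleLieGroup G →
    ∀ (r : LatticeRep G), (∃ a : ℝ → ℝ, Continuous a ∧ TwoPointPackage r a) → FixedTorusAnchors r

/-- **Composition statement I of the line (stub `stub_ratioFloorOfTransports`, pure real analysis): anchors + the three
sign-free transports ⇒ a ratio floor on the femto boxes of an honest unit map.**  Named so that the skeleton's
`FemtoCurvatureSkewnessC_of` takes it as a hypothesis by name (crux protocol); proved in
`LangevinControlUVFemtoCurvatureSkewnessCStubRatioFloorOfTransports.lean` (the dyadic descent: separation `n ↦ 2^k n₀`,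
rounding `L ↦ 2^k⌊L/2^k⌋`, aspect ratio `↦ 2^k K₀ n₀`, `k` cutoff halvings along `a(β_j) = 2^{k-j} a(β)` by the intermediate
value theorem, anchor on the finite family `1 ≤ n₀ < 2N₀`, `8n₀ ≤ L₀ ≤ K₀n₀`). -/
def RatioFloorOfTransports : Prop :=
  ∀ (G : Type) [Group G] [TopologicalSpace G] [IsTopologicalGroup G] [CompactSpace G]
    [MeasurableSpace G] [BorelSpace G] (r : LatticeRep G) (a : ℝ → ℝ),
    IsHonestUnitMap a → FixedTorusAnchors r → CutoffTransport r a → VolumeTransport r a →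
      SeparationTransport r a → RatioFloor r a

/-- **Composition statement II of the line (stub `stub_signedRigidityOfRatioFloor`, elementary): a ratio floor on the femto
boxes of a PACKAGE map gives signed rigidity there** — `κ₃ = u · Cov^{3/2} · G_d/G_a ≥ u₁ ρ₀ · Cov · √Cov` by the landed
`TreeRatioFloor` (`ρ₀ G_a ≤ G_d`), `torusPropAxis_pos` / `torusPropDiag_pos`, and `Cov_axis > 0` on package boxes (the package's
lower clause).  Named for the same reason. -/
def SignedRigidityOfRatioFloor : Prop :=
  ∀ (G : Type) [Group G] [TopologicalSpace G] [IsTopologicalGroup G] [CompactSpace G]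
    [MeasurableSpace G] [BorelSpace G] (r : LatticeRep G) (a : ℝ → ℝ),
    TwoPointPackage r a → RatioFloor r a → SignedRigidity r a

/-! ## The registered stub signatures of the skeleton `Cruxes/FemtoCurvatureSkewnessC/Lines/Sketch.lean`

The crux protocol registers each stub as `theorem stub_<name> : Sig.stub_<name>`; the four `Sig` propositions live here so that
the stubs are landable from `Theorems/` with exactly that header.  Abbreviations only; nothing asserted. -/

/-- Registered signature of stub E (the engine). -/
def Sig.stub_ratioTransportEngine : Prop := RatioTransportEngine

/-- Registered signature of stub A (the anchors). -/
def Sig.stub_anchors : Prop := Anchors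

/-- Registered signature of the first composition stub (the descent). -/
def Sig.stub_ratioFloorOfTransports : Prop := RatioFloorOfTransports

/-- Registered signature of the second composition stub (floor ⇒ signed rigidity). -/
def Sig.stub_signedRigidityOfRatioFloor : Prop := SignedRigidityOfRatioFloor

end Summit.QuantumFields.YangMills.Cruxes.FemtoCurvatureSkewnessC.RatioTransport

end
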